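import Summits.CriticalPhenomena.PercolationContinuityZ3.Theorems.PercNearOneGluingNoHeavyLowerTailThreePartitionVOrderNested

/-!
# Twisted three-partition positivity (★★): the COMB-LEVEL SATURATION REDUCTION —
# on every finite ground set and for every twist, `N_τ ≥ 0` is decided on the triples co-generated by 3-COLOURED ANTICHAINS

Support file (cell `prim-sahi`, seat `prim-sahi-typer` gen 33; `--supports stmt-CriticalPhenomena-4575`).  Pure proofs, no definitions,
no `sorry`, standard axioms.  Vocabulary of `…ThreePartitionADTwisted` (`triT`, `topT`, `deeT`, `teeT`, `threePartNT`,
`teeT_le_deeT`) and `…ThreePartitionVOrderNested` (`threePartNT_swap12`, `threePartNT_swap23`).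

THE MATHEMATICS.  Two saturation reductions are in the tree: the VALUE level (`SahiAbsorbed.exists_saturated_le`,
`sahiPositive_of_colouring`: Sahi's `C_{n+2}(μ)` for one FKG weight `μ` is decided on the families co-generated by
`(n+2)`-coloured antichains, the step being the sign law `E_{n+2}(1_{U_i ∪ {y}}, …) ≤ E_{n+2}(1_{U_i}, …)` for a maximal non-element `y`
of `U_i` lying outside another member — a consequence of `C_{≤ n+1}(μ)`) and the PATTERN level (`SahiSlot.exists_saturated_le`).  Neither
touches the COMB level — positivity of the tensor-Bernstein coefficients of `p ↦ E₃(μ_p; 1_U, 1_V, 1_W)` for ALL product measures at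
once, equivalently (`…ThreePartitionCombBridge(Converse)`) twisted three-partition positivity (★★):
`N_τ(𝒰,𝒱,𝒲) = 2·topT(𝒰∩𝒱∩𝒲) + teeT(𝒰,𝒱,𝒲) − Σ_cyc deeT(𝒰, 𝒱∩𝒲) ≥ 0` for up-sets `𝒰, 𝒱, 𝒲 ⊆ 2^ι` and every twist `τ ⊆ ι`.
This file supplies it.

1. **Abstract saturation** (`Saturation.exists_saturated_le`, `Saturation.le_of_colouring`): for ANY functional `Φ` on `k`-families
   of finsets of a finite partial order with values in a preorder, if adding to a member `W_i` a maximal non-element `y` that lies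
   outside some other member `W_j` never increases `Φ` (the "sign-law step"), then every family of up-sets is dominated by a SATURATED
   family of up-sets (slotwise larger, `Φ` not larger; saturated = every maximal non-element of each member lies in every other member),
   and the saturated families are exactly the families `U_i = {q | ∀ p ∈ N, c p = i → ¬ q ≤ p}` co-generated by an antichain `N`
   with a colouring `c` — so a lower bound for `Φ` on the co-generated families is a lower bound on all families of up-sets.  (The
   potential argument of `SahiAbsorbed.exists_saturated_le`, verbatim, with the functional abstracted.)
2. **The comb sign law** (`ThreePartition.threePartNT_insert_le`): for `y ∉ 𝒰`, `y ∉ 𝒱`, and up-sets `𝒱, 𝒲` (no hypothesis on `𝒰`),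
   `N_τ(𝒰 ∪ {y}, 𝒱, 𝒲) − N_τ(𝒰,𝒱,𝒲) = teeT({y},𝒱,𝒲) − deeT({y}, 𝒱∩𝒲) − [y ∈ 𝒲]·deeT(𝒱,{y}) ≤ 0`, because
   `teeT(𝒳,𝒱,𝒲) ≤ deeT(𝒳,𝒱∩𝒲)` holds for an ARBITRARY spectator family `𝒳` (`teeT_le_deeT`, the fibrewise four-functions theorem —
   here Kleitman's lemma on the fibre over the part `S₁ = y ∆ τ`).  By the symmetry of `N_τ` the step holds in every slot
   (`threePartNT_update_insert_le`).
3. **(★★) is decided on coloured antichains** (`ThreePartition.threePartNT_nonneg_of_colouring`): for every finite `ι` and twist `τ`, if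
   `N_τ ≥ 0` on the triples `({S | ∀ T ∈ N, c T = 0 → ¬ S ⊆ T}, {… = 1 …}, {… = 2 …})` for all antichains `N ⊆ 2^ι` and colourings
   `c : 2^ι → Fin 3`, then `N_τ(𝒰,𝒱,𝒲) ≥ 0` for all up-sets.  Consumers: `…SahiC3CubeColourComb` (the tree's certificate
   `SahiC3Cube.colourCheck_five` of typer gen 27 IS a comb certificate on exactly these triples) and `…SahiC3CombCubeFive` ((★★) = (M⁺-3)
   on five letters; `SahiGridPattern.ResolvedPos 5`).
Nothing here asserts (★★), (M⁺-3), Kahn's Conjecture 5 or Sahi's `C₃` in general. [this work]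
-/

namespace Summit.CriticalPhenomena.PercolationContinuityZ3.Theorems

open Finset Function

/-! ## 1. Abstract saturation -/

namespace Saturation

open scoped Classical

variable {α : Type*} [Fintype α] [PartialOrder α] {γ : Type*} [Preorder γ] {k : ℕ}

/-- **ABSTRACT SATURATION.**  Let `Φ` be any functional on `k`-families of finsets of a finite partial order, with values in a preorder,
satisfying the SIGN-LAW STEP: for a family of up-sets `W`, a member `W i`, a maximal non-element `y` of `W i` lying outside some other
member `W j`, `Φ (W with W i ↦ W i ∪ {y}) ≤ Φ W`.  Then every family of up-sets `U` is dominated by a SATURATED family of up-sets `V`: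
`U i ⊆ V i`, every maximal non-element of each `V i` lies in every other `V j`, and `Φ V ≤ Φ U`.  (Potential argument: the total size
strictly increases at each step and is bounded.) [this work] -/
theorem exists_saturated_le (Φ : (Fin k → Finset α) → γ)
    (hstep : ∀ W : Fin k → Finset α, (∀ j, IsUpperSet (W j : Set α)) →
      ∀ i j, i ≠ j → ∀ y, y ∉ W i → (∀ z, y < z → z ∈ W i) → y ∉ W j →
        Φ (update W i (insert y (W i))) ≤ Φ W)
    (U : Fin k → Finset α) (hU : ∀ i, IsUpperSet (U i : Set α)) :
    ∃ V : Fin k → Finset α, (∀ i, IsUpperSet (V i : Set α)) ∧ (∀ i, U i ⊆ V i) ∧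
      (∀ i j, i ≠ j → ∀ y, y ∉ V i → (∀ z, y < z → z ∈ V i) → y ∈ V j) ∧ Φ V ≤ Φ U := by
  set M := k * Fintype.card α with hM
  have hbound : ∀ W : Fin k → Finset α, ∑ i, (W i).card ≤ M := by
    intro W
    calc ∑ i, (W i).card ≤ ∑ _i : Fin k, Fintype.card α := sum_le_sum fun i _ => card_le_univ _
      _ = M := by rw [sum_const, card_univ, Fintype.card_fin, smul_eq_mul]
  suffices H : ∀ m (W : Fin k → Finset α), M - ∑ i, (W i).card = m → (∀ i, IsUpperSet (W i : Set α)) →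
      ∃ V : Fin k → Finset α, (∀ i, IsUpperSet (V i : Set α)) ∧ (∀ i, W i ⊆ V i) ∧
        (∀ i j, i ≠ j → ∀ y, y ∉ V i → (∀ z, y < z → z ∈ V i) → y ∈ V j) ∧ Φ V ≤ Φ W from H _ U rfl hU
  intro m
  induction m using Nat.strong_induction_on with
  | _ m ih =>
    intro W hm hW
    by_cases hsat : ∀ i j, i ≠ j → ∀ y, y ∉ W i → (∀ z, y < z → z ∈ W i) → y ∈ W j
    · exact ⟨W, hW, fun i => Subset.rfl, hsat, le_rfl⟩
    push Not at hsat
    obtain ⟨i, j, hij, y, hyi, hymax, hyj⟩ := hsat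
    set W' : Fin k → Finset α := update W i (insert y (W i)) with hW'
    have hW'i : W' i = insert y (W i) := by rw [hW', update_self]
    have hW'k : ∀ l, l ≠ i → W' l = W l := fun l hl => by rw [hW', update_of_ne hl]
    have hup : ∀ l, IsUpperSet (W' l : Set α) := by
      intro l
      by_cases hl : l = i
      · subst hl
        rw [hW'i]
        intro a b hab ha
        rw [mem_coe, mem_insert] at ha ⊢
        rcases ha with rfl | ha
        · rcases eq_or_lt_of_le hab with rfl | hlt
          · exact Or.inl rfl
          · exact Or.inr (hymax b hlt)
        · exact Or.inr (hW l hab ha)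
      · rw [hW'k l hl]; exact hW l
    have hsub : ∀ l, W l ⊆ W' l := by
      intro l
      by_cases hl : l = i
      · subst hl; rw [hW'i]; exact subset_insert _ _
      · rw [hW'k l hl]
    have hcard : ∑ l, (W' l).card = ∑ l, (W l).card + 1 := by
      have h1 : ∑ l, (W' l).card = ∑ l, ((W l).card + if l = i then 1 else 0) := by
        refine sum_congr rfl fun l _ => ?_
        by_cases hl : l = i
        · subst hl; rw [hW'i, card_insert_of_notMem hyi, if_pos rfl]
        · rw [hW'k l hl, if_neg hl, add_zero]
      rw [h1, sum_add_distrib, sum_ite_eq' univ i, if_pos (mem_univ _)]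
    have hm' : M - ∑ l, (W' l).card < m := by
      have := hbound W'
      omega
    obtain ⟨V, hV, hWV, hVsat, hVle⟩ := ih _ hm' W' rfl hup
    refine ⟨V, hV, fun l => (hsub l).trans (hWV l), hVsat, hVle.trans ?_⟩
    rw [hW']
    exact hstep W hW i j hij y hyi hymax hyj

/-- **A SATURATED family of up-sets is CO-GENERATED BY A COLOURED ANTICHAIN, so a lower bound on the co-generated families is a lower
bound everywhere.**  Under the sign-law step: if `g ≤ Φ` on every family `U_i = {q | ∀ p ∈ N, c p = i → ¬ q ≤ p}` co-generated by an
antichain `N` with a colouring `c : α → Fin (k+1)`, then `g ≤ Φ U` for every family `U` of up-sets.  (`N` = the maximal non-elements of the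
members of the saturated family, `c` = the member a point is a maximal non-element of — unique by saturation; `N` is an antichain because a
maximal non-element of `V_i` below one of `V_j` would lie in `V_j`, by saturation, and then so would the larger one.) [this work] -/
theorem le_of_colouring (Φ : (Fin (k + 1) → Finset α) → γ)
    (hstep : ∀ W : Fin (k + 1) → Finset α, (∀ j, IsUpperSet (W j : Set α)) →
      ∀ i j, i ≠ j → ∀ y, y ∉ W i → (∀ z, y < z → z ∈ W i) → y ∉ W j →
        Φ (update W i (insert y (W i))) ≤ Φ W)
    {g : γ}
    (h : ∀ (N : Finset α) (c : α → Fin (k + 1)), IsAntichain (· ≤ ·) (N : Set α) →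
      g ≤ Φ (fun i => univ.filter fun q : α => ∀ p ∈ N, c p = i → ¬ q ≤ p))
    (U : Fin (k + 1) → Finset α) (hU : ∀ i, IsUpperSet (U i : Set α)) : g ≤ Φ U := by
  obtain ⟨V, hV, -, hsat, hle⟩ := exists_saturated_le Φ hstep U hU
  refine le_trans ?_ hle
  -- above every non-element of `V i` lies a maximal non-element
  have hmax : ∀ (i : Fin (k + 1)) (q : α), q ∉ V i → ∃ p, q ≤ p ∧ p ∉ V i ∧ ∀ z, p < z → z ∈ V i := by
    intro i q hq
    set S : Finset α := univ.filter fun p => q ≤ p ∧ p ∉ V i with hS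
    have hqS : q ∈ S := by rw [hS, mem_filter]; exact ⟨mem_univ _, le_rfl, hq⟩
    obtain ⟨p, hpmax⟩ := S.exists_maximal ⟨q, hqS⟩
    have hpS : p ∈ S := hpmax.1
    rw [hS, mem_filter] at hpS
    refine ⟨p, hpS.2.1, hpS.2.2, fun z hz => ?_⟩
    by_contra hzV
    have hzS : z ∈ S := by rw [hS, mem_filter]; exact ⟨mem_univ _, hpS.2.1.trans (le_of_lt hz), hzV⟩
    exact absurd (hpmax.2 hzS (le_of_lt hz)) (not_le_of_gt hz)
  set N : Finset α := univ.filter fun p => ∃ i, p ∉ V i ∧ ∀ z, p < z → z ∈ V i with hN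
  have hc : ∀ p : α, ∃ i : Fin (k + 1), (p ∈ N → p ∉ V i ∧ ∀ z, p < z → z ∈ V i) := by
    intro p
    by_cases hp : p ∈ N
    · rw [hN, mem_filter] at hp
      obtain ⟨i, hi⟩ := hp.2
      exact ⟨i, fun _ => hi⟩
    · exact ⟨0, fun h' => (hp h').elim⟩
  choose c hcspec using hc
  have huniq : ∀ {p : α} {i i' : Fin (k + 1)}, p ∉ V i → (∀ z, p < z → z ∈ V i) → p ∉ V i' → i = i' := by
    intro p i i' hi himax hi'
    by_contra hne
    exact hi' (hsat i i' hne p hi himax)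
  have hVeq : (fun i => univ.filter fun q : α => ∀ p ∈ N, c p = i → ¬ q ≤ p) = V := by
    funext i
    ext q
    rw [mem_filter]
    constructor
    · rintro ⟨-, hq⟩
      by_contra hqV
      obtain ⟨p, hqp, hpV, hpmax⟩ := hmax i q hqV
      have hpN : p ∈ N := by rw [hN, mem_filter]; exact ⟨mem_univ _, i, hpV, hpmax⟩
      exact hq p hpN (huniq (hcspec p hpN).1 (hcspec p hpN).2 hpV) hqp
    · intro hq
      refine ⟨mem_univ _, fun p hpN hpi hqp => ?_⟩
      have hpV : p ∉ V (c p) := (hcspec p hpN).1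
      rw [hpi] at hpV
      exact hpV (hV i hqp hq)
  have hanti : IsAntichain (· ≤ ·) (N : Set α) := by
    intro p hp p' hp' hne hle
    rw [mem_coe] at hp hp'
    have h1 := hcspec p hp
    have h2 := hcspec p' hp'
    have hlt : p < p' := lt_of_le_of_ne hle hne
    by_cases hcc : c p = c p'
    · have : p' ∈ V (c p) := h1.2 p' hlt
      rw [hcc] at this
      exact h2.1 this
    · exact h2.1 (hV (c p') hle (hsat (c p) (c p') hcc p h1.1 h1.2))
  have := h N c hanti
  rwa [hVeq] at this

end Saturation

/-! ## 2. The comb sign law for the twisted three-partition functional -/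

namespace ThreePartition

open scoped symmDiff Classical

variable {ι : Type*} [Fintype ι]

/-- Additivity of the twisted count over a disjoint disjunction of predicates. [this work] -/
theorem triT_or (τ : Set ι) {p p' : Set ι → Set ι → Set ι → Prop} (h : ∀ a b c, ¬ (p a b c ∧ p' a b c)) :
    triT τ (fun a b c => p a b c ∨ p' a b c) = triT τ p + triT τ p' := by
  unfold triT tri
  rw [← card_union_of_disjoint]
  · congr 1
    ext q
    simp only [mem_filter, mem_union, mem_univ, true_and]
    tauto
  · exact disjoint_filter.2 fun q _ h1 h2 => h _ _ _ ⟨h1.2, h2.2⟩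

/-- Slot-one additivity of `teeT` over a new point: `teeT(𝒰 ∪ {y}) = teeT(𝒰) + teeT({y})` for `y ∉ 𝒰`. [this work] -/
theorem teeT_insert (τ : Set ι) {𝒰 : Set (Set ι)} {y : Set ι} (hy : y ∉ 𝒰) (𝒱 𝒲 : Set (Set ι)) :
    teeT τ (insert y 𝒰) 𝒱 𝒲 = teeT τ 𝒰 𝒱 𝒲 + teeT τ {y} 𝒱 𝒲 := by
  unfold teeT
  rw [← triT_or]
  · exact triT_congr fun a b c => by simp only [Set.mem_insert_iff, Set.mem_singleton_iff]; tauto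
  · intro a b c hh
    have h1 : a ∈ 𝒰 := hh.1.1
    have h2 : a = y := by simpa only [Set.mem_singleton_iff] using hh.2.1
    exact hy (h2 ▸ h1)

/-- Slot-one additivity of `deeT`: `deeT(𝒜 ∪ {y}, ℬ) = deeT(𝒜, ℬ) + deeT({y}, ℬ)` for `y ∉ 𝒜`. [this work] -/
theorem deeT_insert_left (τ : Set ι) {𝒜 : Set (Set ι)} {y : Set ι} (hy : y ∉ 𝒜) (ℬ : Set (Set ι)) :
    deeT τ (insert y 𝒜) ℬ = deeT τ 𝒜 ℬ + deeT τ {y} ℬ := by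
  unfold deeT
  rw [← triT_or]
  · exact triT_congr fun a b c => by simp only [Set.mem_insert_iff, Set.mem_singleton_iff]; tauto
  · intro a b c hh
    have h1 : a ∈ 𝒜 := hh.1.1
    have h2 : a = y := by simpa only [Set.mem_singleton_iff] using hh.2.1
    exact hy (h2 ▸ h1)

/-- Slot-two additivity of `deeT`: `deeT(𝒜, ℬ ∪ {y}) = deeT(𝒜, ℬ) + deeT(𝒜, {y})` for `y ∉ ℬ`. [this work] -/
theorem deeT_insert_right (τ : Set ι) (𝒜 : Set (Set ι)) {ℬ : Set (Set ι)} {y : Set ι} (hy : y ∉ ℬ) :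
    deeT τ 𝒜 (insert y ℬ) = deeT τ 𝒜 ℬ + deeT τ 𝒜 {y} := by
  unfold deeT
  rw [← triT_or]
  · exact triT_congr fun a b c => by simp only [Set.mem_insert_iff, Set.mem_singleton_iff]; tauto
  · intro a b c hh
    have h1 : c ∈ ℬ := hh.1.2
    have h2 : c = y := by simpa only [Set.mem_singleton_iff] using hh.2.2
    exact hy (h2 ▸ h1)

/-- **THE COMB SIGN LAW (slot one).**  For `y ∉ 𝒰`, `y ∉ 𝒱` and up-sets `𝒱, 𝒲` (no hypothesis on `𝒰`):
`N_τ(𝒰 ∪ {y}, 𝒱, 𝒲) ≤ N_τ(𝒰, 𝒱, 𝒲)`.  The difference is `teeT({y},𝒱,𝒲) − deeT({y},𝒱∩𝒲) − [y ∈ 𝒲]·deeT(𝒱,{y})`, and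
`teeT(𝒳,𝒱,𝒲) ≤ deeT(𝒳,𝒱∩𝒲)` for ANY spectator `𝒳` (`teeT_le_deeT`: four functions / Kleitman on each folding fibre). [this work] -/
theorem threePartNT_insert_le (τ : Set ι) {𝒰 𝒱 𝒲 : Set (Set ι)} (h𝒱 : IsUpperSet 𝒱) (h𝒲 : IsUpperSet 𝒲)
    {y : Set ι} (hy𝒰 : y ∉ 𝒰) (hy𝒱 : y ∉ 𝒱) :
    threePartNT τ (insert y 𝒰) 𝒱 𝒲 ≤ threePartNT τ 𝒰 𝒱 𝒲 := by
  have htop : insert y 𝒰 ∩ 𝒱 ∩ 𝒲 = 𝒰 ∩ 𝒱 ∩ 𝒲 := by rw [Set.insert_inter_of_notMem hy𝒱]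
  have hUV : insert y 𝒰 ∩ 𝒱 = 𝒰 ∩ 𝒱 := Set.insert_inter_of_notMem hy𝒱
  have hkey : teeT τ {y} 𝒱 𝒲 ≤ deeT τ {y} (𝒱 ∩ 𝒲) := teeT_le_deeT τ {y} h𝒱 h𝒲
  unfold threePartNT
  rw [htop, hUV, teeT_insert τ hy𝒰, deeT_insert_left τ hy𝒰]
  by_cases hy𝒲 : y ∈ 𝒲
  · have hUW : insert y 𝒰 ∩ 𝒲 = insert y (𝒰 ∩ 𝒲) := Set.insert_inter_of_mem hy𝒲
    have hy' : y ∉ 𝒰 ∩ 𝒲 := fun hh => hy𝒰 hh.1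
    rw [hUW, deeT_insert_right τ 𝒱 hy']
    push_cast
    have h0 : (0 : ℤ) ≤ (deeT τ 𝒱 {y} : ℤ) := by exact_mod_cast Nat.zero_le _
    have h1 : (teeT τ {y} 𝒱 𝒲 : ℤ) ≤ (deeT τ {y} (𝒱 ∩ 𝒲) : ℤ) := by exact_mod_cast hkey
    linarith
  · have hUW : insert y 𝒰 ∩ 𝒲 = 𝒰 ∩ 𝒲 := Set.insert_inter_of_notMem hy𝒲
    rw [hUW]
    push_cast
    have h1 : (teeT τ {y} 𝒱 𝒲 : ℤ) ≤ (deeT τ {y} (𝒱 ∩ 𝒲) : ℤ) := by exact_mod_cast hkey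
    linarith

/-- The comb sign law, slot one, the new point lying outside the SECOND or the THIRD member. [this work] -/
theorem threePartNT_insert_le' (τ : Set ι) {𝒰 𝒱 𝒲 : Set (Set ι)} (h𝒱 : IsUpperSet 𝒱) (h𝒲 : IsUpperSet 𝒲)
    {y : Set ι} (hy𝒰 : y ∉ 𝒰) (hy : y ∉ 𝒱 ∨ y ∉ 𝒲) :
    threePartNT τ (insert y 𝒰) 𝒱 𝒲 ≤ threePartNT τ 𝒰 𝒱 𝒲 := by
  rcases hy with hy𝒱 | hy𝒲
  · exact threePartNT_insert_le τ h𝒱 h𝒲 hy𝒰 hy𝒱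
  · rw [threePartNT_swap23 τ (insert y 𝒰), threePartNT_swap23 τ 𝒰]
    exact threePartNT_insert_le τ h𝒲 h𝒱 hy𝒰 hy𝒲

/-- **The sign-law step in every slot** for the functional `F ↦ N_τ(F 0, F 1, F 2)` on `Fin 3`-families of finsets of `2^ι`: adding to
the member `F i` a point outside `F i` and outside another member `F j` does not increase `N_τ` (the other two members being up-sets).
[this work] -/
theorem threePartNT_update_insert_le (τ : Set ι) (F : Fin 3 → Finset (Set ι))
    (hF : ∀ j, IsUpperSet (F j : Set (Set ι))) (i j : Fin 3) (hij : i ≠ j) (y : Set ι) (hyi : y ∉ F i) (hyj : y ∉ F j) :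
    threePartNT τ ↑(update F i (insert y (F i)) 0) ↑(update F i (insert y (F i)) 1) ↑(update F i (insert y (F i)) 2)
      ≤ threePartNT τ ↑(F 0) ↑(F 1) ↑(F 2) := by
  have hyi' : y ∉ (F i : Set (Set ι)) := fun hh => hyi (mem_coe.1 hh)
  have hyj' : y ∉ (F j : Set (Set ι)) := fun hh => hyj (mem_coe.1 hh)
  have h10 : (1 : Fin 3) ≠ 0 := by decide
  have h20 : (2 : Fin 3) ≠ 0 := by decide
  have h01 : (0 : Fin 3) ≠ 1 := by decide
  have h21 : (2 : Fin 3) ≠ 1 := by decide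
  have h02 : (0 : Fin 3) ≠ 2 := by decide
  have h12 : (1 : Fin 3) ≠ 2 := by decide
  have hi : i = 0 ∨ i = 1 ∨ i = 2 := by fin_cases i <;> simp
  have hj : j = 0 ∨ j = 1 ∨ j = 2 := by fin_cases j <;> simp
  rcases hi with rfl | rfl | rfl <;> rcases hj with rfl | rfl | rfl
  -- i = 0
  · exact absurd rfl hij
  · rw [update_self, update_of_ne h10, update_of_ne h20, coe_insert]
    exact threePartNT_insert_le' τ (hF 1) (hF 2) hyi' (Or.inl hyj')
  · rw [update_self, update_of_ne h10, update_of_ne h20, coe_insert]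
    exact threePartNT_insert_le' τ (hF 1) (hF 2) hyi' (Or.inr hyj')
  -- i = 1
  · rw [update_self, update_of_ne h01, update_of_ne h21, coe_insert,
      threePartNT_swap12 τ ↑(F 0) (insert y ↑(F 1)), threePartNT_swap12 τ ↑(F 0) ↑(F 1)]
    exact threePartNT_insert_le' τ (hF 0) (hF 2) hyi' (Or.inl hyj')
  · exact absurd rfl hij
  · rw [update_self, update_of_ne h01, update_of_ne h21, coe_insert,
      threePartNT_swap12 τ ↑(F 0) (insert y ↑(F 1)), threePartNT_swap12 τ ↑(F 0) ↑(F 1)]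
    exact threePartNT_insert_le' τ (hF 0) (hF 2) hyi' (Or.inr hyj')
  -- i = 2
  · rw [update_self, update_of_ne h02, update_of_ne h12, coe_insert,
      threePartNT_swap23 τ ↑(F 0) ↑(F 1) (insert y ↑(F 2)), threePartNT_swap12 τ ↑(F 0) (insert y ↑(F 2)),
      threePartNT_swap23 τ ↑(F 0) ↑(F 1) ↑(F 2), threePartNT_swap12 τ ↑(F 0) ↑(F 2)]
    exact threePartNT_insert_le' τ (hF 0) (hF 1) hyi' (Or.inl hyj')
  · rw [update_self, update_of_ne h02, update_of_ne h12, coe_insert,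
      threePartNT_swap23 τ ↑(F 0) ↑(F 1) (insert y ↑(F 2)), threePartNT_swap12 τ ↑(F 0) (insert y ↑(F 2)),
      threePartNT_swap23 τ ↑(F 0) ↑(F 1) ↑(F 2), threePartNT_swap12 τ ↑(F 0) ↑(F 2)]
    exact threePartNT_insert_le' τ (hF 0) (hF 1) hyi' (Or.inr hyj')
  · exact absurd rfl hij

/-! ## 3. (★★) is decided on the coloured antichains -/

/-- **TWISTED THREE-PARTITION POSITIVITY IS DECIDED ON 3-COLOURED ANTICHAINS.**  Fix a finite ground set `ι` and a twist `τ ⊆ ι`.  If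
`N_τ ≥ 0` on every triple `({S | ∀ T ∈ N, c T = 0 → ¬ S ⊆ T}, {S | ∀ T ∈ N, c T = 1 → ¬ S ⊆ T}, {S | ∀ T ∈ N, c T = 2 → ¬ S ⊆ T})`
co-generated by an antichain `N ⊆ 2^ι` (for `⊆`) with a colouring `c : 2^ι → Fin 3`, then `N_τ(𝒰,𝒱,𝒲) ≥ 0` for ALL up-sets
`𝒰, 𝒱, 𝒲 ⊆ 2^ι`. [this work] -/
theorem threePartNT_nonneg_of_colouring (τ : Set ι)
    (h : ∀ (N : Finset (Set ι)) (c : Set ι → Fin 3), IsAntichain (· ≤ ·) (N : Set (Set ι)) →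
      0 ≤ threePartNT τ {S | ∀ T ∈ N, c T = 0 → ¬ S ⊆ T} {S | ∀ T ∈ N, c T = 1 → ¬ S ⊆ T}
        {S | ∀ T ∈ N, c T = 2 → ¬ S ⊆ T})
    {𝒰 𝒱 𝒲 : Set (Set ι)} (h𝒰 : IsUpperSet 𝒰) (h𝒱 : IsUpperSet 𝒱) (h𝒲 : IsUpperSet 𝒲) :
    0 ≤ threePartNT τ 𝒰 𝒱 𝒲 := by
  -- the functional on `Fin 3`-families of finsets of `2^ι`
  let Φ : (Fin 3 → Finset (Set ι)) → ℤ := fun F => threePartNT τ ↑(F 0) ↑(F 1) ↑(F 2)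
  let F : Fin 3 → Finset (Set ι) := ![univ.filter (· ∈ 𝒰), univ.filter (· ∈ 𝒱), univ.filter (· ∈ 𝒲)]
  have hcoe : ∀ 𝒳 : Set (Set ι), (↑(univ.filter (· ∈ 𝒳)) : Set (Set ι)) = 𝒳 := by
    intro 𝒳; ext S; simp
  have hF0 : (↑(F 0) : Set (Set ι)) = 𝒰 := hcoe 𝒰
  have hF1 : (↑(F 1) : Set (Set ι)) = 𝒱 := hcoe 𝒱
  have hF2 : (↑(F 2) : Set (Set ι)) = 𝒲 := hcoe 𝒲
  have hFup : ∀ i, IsUpperSet (F i : Set (Set ι)) := by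
    intro i; fin_cases i
    · show IsUpperSet (↑(F 0) : Set (Set ι)); rw [hF0]; exact h𝒰
    · show IsUpperSet (↑(F 1) : Set (Set ι)); rw [hF1]; exact h𝒱
    · show IsUpperSet (↑(F 2) : Set (Set ι)); rw [hF2]; exact h𝒲
  have hgoal : (0 : ℤ) ≤ Φ F := by
    refine Saturation.le_of_colouring Φ (fun W hW i j hij y hyi _ hyj => ?_) (fun N c hN => ?_) F hFup
    · exact threePartNT_update_insert_le τ W hW i j hij y hyi hyj
    · have key := h N c hN
      show (0 : ℤ) ≤ threePartNT τ _ _ _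
      beta_reduce
      convert key using 2 <;> (ext S; simp)
  show (0 : ℤ) ≤ threePartNT τ 𝒰 𝒱 𝒲
  rw [← hF0, ← hF1, ← hF2]
  exact hgoal

end ThreePartition

end Summit.CriticalPhenomena.PercolationContinuityZ3.Theorems
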